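/-
Copyright: the b2b-balaban T⁴-continuum CRUX team, row NE7b leaf lineage `t4-ne7b-formalise-leaf-01` (gen 85). Project licence.
-/
import Mathlib.Analysis.Normed.Group.Constructions
import Mathlib.Analysis.SpecialFunctions.Pow.Real
import Mathlib.Algebra.Order.Chebyshev
import Mathlib.Tactic.Positivity
import Mathlib.Tactic.Linarith
import Mathlib.Tactic.FieldSimp

/-!
# THE SAME TWO OPERATORS IN THE SUP-NORM CURRENCY: the block-constant section is an ISOMETRY (`‖k ∘ blk‖_∞ = ‖k‖_∞`, `μ_∞ = 1`) and the
# block average is a CONTRACTION (`‖Tv‖_∞ ≤ ‖v‖_∞`, `d_∞ ≤ 1`), so the embed-then-rescale number of `…HardStepRadiusObstruction` is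
# `|t|·μ_∞ = |t| = (L²∕L^d)^{1∕2} < 1` exactly when `d ≥ 3` (`L > 1`) — the currency in which the radius letter `s < 1` is a CONDITION ON `L`
# (`|t|·K₁ < 1`), not an impossibility (row NE7b, node U5c; Mathlib only; [folklore]; the positive companion of HRO's negative letter)

Cell `pub-balaban`, sub-cell `t4`, spine estimate NE7b (`T4WeightBudget.RelWeightBound`; the cell's OWN estimate — NOT PRINTED in
[Bałaban 1983–89], NOT PROVED).  Crux-route work under `Spine/NE7b/` by a row leaf (`t4-ne7b-formalise-leaf-01` gen 85) under FREEZE (0)'s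
crux-prover clause; NOTHING of Bałaban's is named as a Lean object, valued or asserted; no `T4Continuum/Support` leaf typed; no `def`; zero
`sorry`.  Imports: Mathlib only.  Functions `σ → ℝ` ∕ `β → ℝ` carry Mathlib's Pi (sup) norm.

WHY (located).  HRO (this lineage, INTENT-5) makes `t4-ne7b-idea-1` g102's PS-1 a theorem: in the `ℓ²` currency of the hard-step chain the
block-constant section has `‖M₂‖ = √(L^d)`, the canonical rescaling `|t| = √(L²∕L^d)`, so `|t|·‖M₂‖ = L ≥ 1` and HSTB's `s < 1` cannot hold
with HSTT's `hN ∧ hc`.  The obstruction is the CURRENCY's: print's small-field conditions are pointwise.  THIS FILE values the two operators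
in the sup norm — `μ_∞ = 1` (every fibre inhabited), `d_∞ ≤ 1` — so the same product is `|t|·1`, and `t² = L²∕L^d < 1` iff `L² < L^d`,
i.e. for `d ≥ 3` and `L > 1` (`d = 4`: `|t| = L⁻¹`); there the radius letter reads `K₁ < |t|⁻¹ = L^{(d−2)∕2}` — «`L` large against the
chart constant», a condition of print's kind.  Whether AHE ∕ HKB (inner-product files) can be run in a sup-norm currency is NOT HERE — this is
the located arithmetic only, zero weight for the hard-step cell's choice.

WHAT IS PROVED ([folklore]):
* §1 `norm_comp_blk_le` (`‖k ∘ blk‖ ≤ ‖k‖`), `norm_comp_blk_eq` (fibres inhabited ⊢ `‖k ∘ blk‖ = ‖k‖` — `μ_∞ = 1`),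
  **`norm_blockAverage_sup_le`** (`‖Tv‖ ≤ ‖v‖` for the block average, fibres inhabited — `d_∞ ≤ 1`).
* §2 `rescale_sq_lt_one` (`1 < L`, `3 ≤ d` ⊢ `L²∕L^d < 1`), `rescale_sq_ge_one` (`1 ≤ L`, `d ≤ 2` ⊢ `1 ≤ L²∕L^d` — no help in low dimension),
  `rescale_sq_four` (`d = 4`: `L²∕L^4 = (L⁻¹)²`).
* §3 **`radius_letter_iff_supnorm`** (`0 < t`, `μ = 1`: HSTB's `s = |t|K₁ < 1 ↔ K₁ < t⁻¹`) and `radius_letter_supnorm_of_lt` (`K₁ < t⁻¹ ⊢ s < 1`) —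
  the letter is a CONDITION, met for `K₁ < L^{(d−2)∕2}`.

NOT HERE (honest): the chain in sup-norm currency; the coercivity letters (they are `ℓ²` statements and stay so — TSPB ∕ FFTI); which currency print's
(47)–(62) use where ((A3) ∕ (A1c), NC-NE7b-α UNRULED).  BY-NAME EFFECT ON THE WALL: NONE.  NE7b NOT PRINTED ∕ NOT PROVED; spine PROVED 0∕9; rung
(B)+1 on a FINITE torus — NOT infinite volume, NOT the mass gap, NOT Clay.  HONEST DEPENDENCY: continuum YM on T⁴ ⇐ BetaPertH ∧ nine spine
estimates (0∕9 proved); BetaPertH ⇐ (D1) ∧ (D4) ∧ CAP+tail; G-an2-4 gates asym, D1 and NE2∕3∕4.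
-/

set_option autoImplicit false

open Finset

namespace Summit.QuantumFields.BalabanUV.T4Continuum.NE7b.HardStepRadiusSupNorm

variable {σ β : Type*} [Fintype σ] [Fintype β] [DecidableEq β]

/-! ## §1. The section is a sup-norm isometry, the block average a sup-norm contraction -/

omit [DecidableEq β] in
/-- `‖k ∘ blk‖_∞ ≤ ‖k‖_∞`. [folklore] -/
theorem norm_comp_blk_le (blk : σ → β) (k : β → ℝ) : ‖k ∘ blk‖ ≤ ‖k‖ :=
  (pi_norm_le_iff_of_nonneg (norm_nonneg k)).2 fun x => norm_le_pi_norm k (blk x)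

omit [DecidableEq β] in
/-- **`μ_∞ = 1`**: with every fibre inhabited (`blk` surjective), `‖k ∘ blk‖_∞ = ‖k‖_∞`. [folklore] -/
theorem norm_comp_blk_eq (blk : σ → β) (hblk : Function.Surjective blk) (k : β → ℝ) : ‖k ∘ blk‖ = ‖k‖ := by
  refine le_antisymm (norm_comp_blk_le blk k) ((pi_norm_le_iff_of_nonneg (norm_nonneg _)).2 fun y => ?_)
  obtain ⟨x, rfl⟩ := hblk y
  exact norm_le_pi_norm (k ∘ blk) x

/-- **`d_∞ ≤ 1`**: the block average `(Tv)(y) = (Σ_{fibre y} v)∕#fibre(y)` (fibres inhabited) is a sup-norm contraction. [folklore] -/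
theorem norm_blockAverage_sup_le (blk : σ → β) (hfib : ∀ y, 0 < #(univ.filter fun x => blk x = y)) (v : σ → ℝ) :
    ‖(fun y => (∑ x ∈ univ.filter (fun x => blk x = y), v x) / #(univ.filter fun x => blk x = y))‖ ≤ ‖v‖ := by
  refine (pi_norm_le_iff_of_nonneg (norm_nonneg v)).2 fun y => ?_
  have hc : (0 : ℝ) < #(univ.filter fun x => blk x = y) := by exact_mod_cast hfib y
  rw [Real.norm_eq_abs, abs_div, abs_of_pos hc, div_le_iff₀ hc]
  calc |∑ x ∈ univ.filter (fun x => blk x = y), v x| ≤ ∑ x ∈ univ.filter (fun x => blk x = y), |v x| :=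
        abs_sum_le_sum_abs _ _
    _ ≤ ∑ _x ∈ univ.filter (fun x => blk x = y), ‖v‖ :=
        sum_le_sum fun x _ => by rw [← Real.norm_eq_abs]; exact norm_le_pi_norm v x
    _ = ‖v‖ * #(univ.filter fun x => blk x = y) := by rw [sum_const, nsmul_eq_mul, mul_comm]

/-! ## §2. The rescaling number `t² = L²∕L^d` in the sup-norm currency -/

/-- **`d ≥ 3`, `L > 1` ⟹ `t² = L²∕L^d < 1`** (so `|t|·μ_∞ = |t| < 1`). [folklore] -/
theorem rescale_sq_lt_one {L : ℝ} (hL : 1 < L) {d : ℕ} (hd : 3 ≤ d) : L ^ 2 / L ^ d < 1 := by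
  have hL0 : 0 < L := lt_trans zero_lt_one hL
  rw [div_lt_one (pow_pos hL0 d)]
  exact pow_lt_pow_right₀ hL (by omega)

/-- `d ≤ 2`, `L ≥ 1` ⟹ `1 ≤ L²∕L^d`: in low dimension the rescaling does not contract (the sup-norm currency does not help there). [folklore] -/
theorem rescale_sq_ge_one {L : ℝ} (hL : 1 ≤ L) {d : ℕ} (hd : d ≤ 2) : 1 ≤ L ^ 2 / L ^ d := by
  have hL0 : 0 < L := lt_of_lt_of_le zero_lt_one hL
  rw [le_div_iff₀ (pow_pos hL0 d), one_mul]
  exact pow_le_pow_right₀ hL hd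

/-- `d = 4`: `L²∕L⁴ = (L⁻¹)²`, i.e. `|t| = L⁻¹`. [folklore] -/
theorem rescale_sq_four {L : ℝ} (hL : 0 < L) : L ^ 2 / L ^ 4 = (L⁻¹) ^ 2 := by
  have hL' : L ≠ 0 := hL.ne'
  field_simp

/-! ## §3. In the sup-norm currency the radius letter is a condition on the chart constant -/

/-- **`s = |t|·K₁ < 1 ↔ K₁ < t⁻¹`** (`0 < t`): with `μ_∞ = 1` nothing forces `s ≥ 1`; the letter asks `K₁ < t⁻¹ = (L^d∕L²)^{1∕2} = L^{(d−2)∕2}`. [folklore] -/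
theorem radius_letter_iff_supnorm {t K₁ : ℝ} (ht : 0 < t) : |t| * K₁ < 1 ↔ K₁ < t⁻¹ := by
  rw [abs_of_pos ht, ← lt_div_iff₀' ht, one_div]

/-- The letter met: `0 < t`, `K₁ < t⁻¹` ⊢ `|t|·K₁ < 1`. [folklore] -/
theorem radius_letter_supnorm_of_lt {t K₁ : ℝ} (ht : 0 < t) (hK : K₁ < t⁻¹) : |t| * K₁ < 1 :=
  (radius_letter_iff_supnorm ht).2 hK

/-! ## §4. Toy -/

/-- Toy: `d = 4`, `L = 2`: `t = 1∕2`; a chart constant `K₁ = 3∕2 < 2 = t⁻¹` meets the letter (`s = 3∕4`), `K₁ = 5∕2` does not. -/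
example : |(1 / 2 : ℝ)| * (3 / 2) < 1 ∧ ¬ (|(1 / 2 : ℝ)| * (5 / 2) < 1) := by
  rw [abs_of_pos (by norm_num : (0 : ℝ) < 1 / 2)]
  constructor <;> norm_num

end Summit.QuantumFields.BalabanUV.T4Continuum.NE7b.HardStepRadiusSupNorm
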